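import Mathlib

/-!
# SoloBlindDelsarteCensus — the Delsarte members of the closure of the T₈ face (s41)

Solo-blind residency on `HodgeConjecture`, session s41 (companion text `work/s41/delsarte-census.md`,
LEMMA DC; claims SB-C307/308).  Kernel-checked finite core of the census; the Hodge-theoretic reading
(Shioda's character formalism for Delsarte surfaces) is prose and is NOT asserted here.

Informal context (NOT formalised).  The T₈ face of the residency (K3 surfaces with transcendental
lattice `U(2)² ⊕ ⟨-2⟩⁴`, Picard number 14, six moduli) is the family `X_q = Q̃_q / V₄`,
`Q̃_q = {q(u₁²,u₂²,u₃²,u₄²) = 0} ⊂ ℙ³`, `q` a quaternary quadratic form.  A member is *Delsarte* when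
`q` has exactly four monomials with invertible exponent matrix `A′` (rows = monomials, columns =
variables; the quartic `q(u²)` then has exponent matrix `A = 2A′`), and Shioda's algorithm (Amer. J.
Math. 108, 1986) expresses a smooth model as a quotient of the Fermat surface of degree
`m = min {m > 0 | m • A⁻¹ integral}` and reads its Hodge numbers off the characters
`Λ_A ∩ 𝔄_m`, `Λ_A = {α ∈ (ℤ/m)⁴ | α • A ≡ 0}`; in particular `p_g = #{α ∈ Λ_A ∩ 𝔄_m : |α| = 1}` and the
model is K3 iff `p_g = 1`.  The semiregularity door on this face wanted a Fermat-dominated ANCHOR with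
large transcendental rank; LEMMA DC says there is none beyond Picard number 20.

Encoding.  A quadric monomial `v₁^a v₂^b v₃^c v₄^d` (`a+b+c+d = 2`) is the row `(a,b,c,d)`; the ten
monomials are the four squares ("loops") and six products ("edges") of `rows`; a Delsarte candidate is
a 4-element sublist `S` of `rows` (`subsets`, 210 of them), read as the 4×4 integer matrix `A′_S`.

What this file certifies (all by `decide +kernel`, i.e. exhaustive evaluation in the kernel; no
`native_decide`, no extra axioms):
* `invertible_count`, `admissible_count`: 141 candidates have `det A′ ≠ 0`, 137 of them have no
  variable dividing all four monomials (the census population of SB-C308);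
* `det_values`: `det A′ ∈ {±2, ±4, ±8, 16}` whenever it is non-zero (= `±2^{#components}` of the
  odd-unicyclic multigraph, LEMMA DC(a));
* `fermat_degree_four`: for every invertible candidate, `det A′ ∣ 2c` for all sixteen cofactors `c`
  (so `4 • A⁻¹ = adj(A′)/ (det A′/2)`… precisely `m • A⁻¹ = m • adj(A′)/(2 det A′)` is integral for
  `m = 4`) while for `m = 1, 2, 3` some cofactor violates `2 det A′ ∣ m c`: the Fermat degree is
  EXACTLY 4 for all 141 — every Delsarte member is a quotient of the Fermat quartic surface;
* `k3_members`: `det A′ ≠ 0 ∧ all column sums of A′ even` holds for exactly the five candidates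
  `fiveK3` = {four squares (Fermat)} ∪ {one square + the triangle on the other three variables} (4);
* `pg_eq`: for every invertible candidate the character count
  `p_g(S) = #{α ∈ {1,2,3}⁴ : Σαₖ ≡ 0 (4), α • A′_S ≡ 0 (2), Σαₖ = 4}` equals `1` if all column sums are
  even and `0` otherwise (LEMMA DC(b) checked numerically on all 141, independently of the
  composition argument `composition_four`);
* `hodge_characters_fiveK3`: for the five K3 members the type counts `(#|α|=1, #|α|=2, #|α|=3)` are
  `(1,19,1)` (Fermat) and `(1,7,1)` (square + triangle), so `rank T = 2`, `ρ = 20` in all five cases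
  (Shioda: `rank T` = number of characters in `Λ ∩ 𝔄` of type ≠ (1,1), the `(ℤ/4)ˣ`-orbit condition
  being automatic at `m = 4` since `|3α| = 4 - |α|`).
Conclusion drawn in the companion text (prose): no Fermat-dominated point of the T₈-face closure has
transcendental rank > 2; the only Delsarte point of the face proper (all principal minors of the Gram
matrix non-zero, in particular all four squares present) is the Fermat quartic.
-/

namespace Summit.HodgeConjecture.HodgeConjecture.Theorems
namespace DelsarteCensus

/-- An exponent row `(a,b,c,d)` of a quaternary quadric monomial `v₁^a v₂^b v₃^c v₄^d`. -/
abbrev Row := ℤ × ℤ × ℤ × ℤ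

/-- The ten quadric monomials: the squares `v_k²` first, then the products `v_i v_j` (`i < j`). -/
def rows : List Row :=
  [(2,0,0,0), (0,2,0,0), (0,0,2,0), (0,0,0,2),
   (1,1,0,0), (1,0,1,0), (1,0,0,1), (0,1,1,0), (0,1,0,1), (0,0,1,1)]

/-- Entry of a row in column `j`. -/
def col (j : Fin 4) (r : Row) : ℤ :=
  match j, r with
  | ⟨0, _⟩, (a, _, _, _) => a
  | ⟨1, _⟩, (_, b, _, _) => b
  | ⟨2, _⟩, (_, _, c, _) => c
  | ⟨3, _⟩, (_, _, _, d) => d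

/-- Delete column `j`. -/
def dropCol (j : Fin 4) (r : Row) : ℤ × ℤ × ℤ :=
  match j, r with
  | ⟨0, _⟩, (_, b, c, d) => (b, c, d)
  | ⟨1, _⟩, (a, _, c, d) => (a, c, d)
  | ⟨2, _⟩, (a, b, _, d) => (a, b, d)
  | ⟨3, _⟩, (a, b, c, _) => (a, b, c)

/-- 3×3 determinant of three rows. -/
def det3 (x y z : ℤ × ℤ × ℤ) : ℤ :=
  match x, y, z with
  | (a1, a2, a3), (b1, b2, b3), (c1, c2, c3) =>
      a1 * (b2 * c3 - b3 * c2) - a2 * (b1 * c3 - b3 * c1) + a3 * (b1 * c2 - b2 * c1)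

/-- The sign `(-1)^n`. -/
def sgn (n : ℕ) : ℤ := if n % 2 = 0 then 1 else -1

/-- Cofactor `C_{ij}` of the 4×4 matrix whose rows are the 4-element list `S` (else `0`). -/
def cof (S : List Row) (i j : Fin 4) : ℤ :=
  match S with
  | [r0, r1, r2, r3] =>
      match ([r0, r1, r2, r3].eraseIdx i.val) with
      | [s0, s1, s2] => sgn (i.val + j.val) * det3 (dropCol j s0) (dropCol j s1) (dropCol j s2)
      | _ => 0
  | _ => 0

/-- 4×4 determinant (Laplace expansion along the first row). -/
def det4 (S : List Row) : ℤ :=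
  match S with
  | [r0, _, _, _] => (List.finRange 4).foldl (fun acc j => acc + col j r0 * cof S 0 j) 0
  | _ => 0

/-- The sixteen cofactors (= entries of the adjugate, up to transposition). -/
def cofs (S : List Row) : List ℤ :=
  (List.finRange 4).flatMap fun i => (List.finRange 4).map fun j => cof S i j

/-- Column sum `j` = total degree of the variable `v_j` in the four monomials
(= degree of vertex `j` in the multigraph, loops counting 2). -/
def colSum (S : List Row) (j : Fin 4) : ℤ := (S.map (col j)).sum

/-- All four column sums even. -/
def evenCols (S : List Row) : Bool := (List.finRange 4).all fun j => colSum S j % 2 == 0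

/-- No variable divides all four monomials (every column has a zero entry). -/
def noDividingVar (S : List Row) : Bool :=
  (List.finRange 4).all fun j => S.any fun r => col j r == 0

/-- The 210 four-element sublists of `rows` (Delsarte candidates). -/
def subsets : List (List Row) := rows.sublistsLen 4

/-- The invertible candidates (`det A′ ≠ 0`). -/
def invertible : List (List Row) := subsets.filter fun S => det4 S != 0

/-- The five K3 members: Fermat, and "one square + triangle on the other three variables". -/
def fiveK3 : List (List Row) :=
  [ [(2,0,0,0), (0,2,0,0), (0,0,2,0), (0,0,0,2)],
    [(2,0,0,0), (0,1,1,0), (0,1,0,1), (0,0,1,1)],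
    [(0,2,0,0), (1,0,1,0), (1,0,0,1), (0,0,1,1)],
    [(0,0,2,0), (1,1,0,0), (1,0,0,1), (0,1,0,1)],
    [(0,0,0,2), (1,1,0,0), (1,0,1,0), (0,1,1,0)] ]

/-! ## §A  Sanity checks of the determinant code -/

/-- Sanity: the identity matrix has determinant `1`. -/
theorem det4_one : det4 [(1,0,0,0), (0,1,0,0), (0,0,1,0), (0,0,0,1)] = 1 := by decide
/-- Sanity: the Fermat candidate `A′ = 2·I` has determinant `16`. -/
theorem det4_fermat : det4 [(2,0,0,0), (0,2,0,0), (0,0,2,0), (0,0,0,2)] = 16 := by decide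
/-- Sanity: triangle + loop has determinant `2 · 2 = 4`. -/
theorem det4_triangle_loop : det4 [(1,1,0,0), (0,1,1,0), (1,0,1,0), (0,0,0,2)] = 4 := by decide
/-- The 4-cycle `v₁v₂, v₂v₃, v₃v₄, v₁v₄` (bipartite) is singular. -/
theorem det4_fourCycle : det4 [(1,1,0,0), (0,1,1,0), (0,0,1,1), (1,0,0,1)] = 0 := by decide

/-! ## §B  The census population -/

/-- There are `C(10,4) = 210` Delsarte candidates. -/
theorem subsets_count : subsets.length = 210 := by decide +kernel

/-- Exactly `141` candidates have `det A′ ≠ 0`. -/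
theorem invertible_count : invertible.length = 141 := by decide +kernel

/-- The census population of SB-C308: invertible and no dividing variable. -/
theorem admissible_count : (invertible.filter noDividingVar).length = 137 := by decide +kernel

/-- `det A′ = ±2^c`, `1 ≤ c ≤ 4` (and `+16` only: the Fermat candidate). -/
theorem det_values :
    (invertible.all fun S => [2, -2, 4, -4, 8, -8, 16].contains (det4 S)) = true := by
  decide +kernel

/-! ## §C  Fermat degree `m = 4` for every invertible candidate

`m • A⁻¹ = m • adj(A′) / (2 • det A′)` with `adj(A′)ᵀ = (cof S i j)`; integrality for `m = 4` is
`det A′ ∣ 2 c`, failure for `m ∈ {1,2,3}` is `¬ (2 det A′ ∣ m c)` for some cofactor `c`. -/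

/-- The Fermat degree is exactly `4` for every invertible candidate: `4 • A⁻¹` is integral
(`det A′ ∣ 2c` for all cofactors) and `m • A⁻¹` is not for `m = 1, 2, 3`. -/
theorem fermat_degree_four :
    (invertible.all fun S =>
      ((cofs S).all fun c => (2 * c) % det4 S == 0) &&
      ([1, 2, 3].all fun m => (cofs S).any fun c => (m * c) % (2 * det4 S) != 0)) = true := by
  decide +kernel

/-! ## §D  The K3 members -/

/-- `det A′ ≠ 0 ∧` all column sums even `⟺` the candidate is one of the five. -/
theorem k3_members :
    (subsets.all fun S => (det4 S != 0 && evenCols S) == fiveK3.contains S) = true := by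
  decide +kernel

/-- The five K3 members are invertible candidates. -/
theorem fiveK3_invertible : (fiveK3.all fun S => invertible.contains S) = true := by decide +kernel

/-- Only the Fermat candidate has all four squares (lies on the face proper); the other four K3
members miss three squares (three coordinate vertices on the quartic). -/
theorem squares_in_fiveK3 :
    (fiveK3.map fun S =>
        (S.filter fun r => [(2,0,0,0), (0,2,0,0), (0,0,2,0), (0,0,0,2)].contains r).length)
      = [4, 1, 1, 1, 1] := by decide +kernel

/-! ## §E  Characters: `p_g` and the Hodge type counts at `m = 4`

`α ∈ {1,2,3}⁴` runs over `𝔄₄` when `Σ αₖ ≡ 0 (mod 4)`; `α ∈ Λ_A` iff `α • A = 2 (α • A′) ≡ 0 (mod 4)`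
iff `α • A′ ≡ 0 (mod 2)`; the type of `α` is `|α| = (Σ αₖ)/4 ∈ {1,2,3}`. -/

/-- The candidate characters `{1,2,3}⁴`. -/
def alphas : List (List ℤ) :=
  [1, 2, 3].flatMap fun a => [1, 2, 3].flatMap fun b => [1, 2, 3].flatMap fun c =>
    [1, 2, 3].map fun d => [a, b, c, d]

/-- `α • A′_S` in column `j`. -/
def pairCol (α : List ℤ) (S : List Row) (j : Fin 4) : ℤ :=
  ((α.zip S).map fun p => p.1 * col j p.2).sum

/-- `α ∈ Λ_A ∩ 𝔄₄` (for `α ∈ {1,2,3}⁴`). -/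
def inLambdaFrakA (S : List Row) (α : List ℤ) : Bool :=
  (α.sum % 4 == 0) && ((List.finRange 4).all fun j => pairCol α S j % 2 == 0)

/-- Number of characters in `Λ_A ∩ 𝔄₄` of type `t` (`Σ αₖ = 4t`). -/
def typeCount (S : List Row) (t : ℤ) : ℕ :=
  (alphas.filter fun α => inLambdaFrakA S α && (α.sum == 4 * t)).length

/-- `p_g` of the smooth model (number of type-1 characters). -/
def pg (S : List Row) : ℕ := typeCount S 1

/-- `|{1,2,3}⁴| = 81`. -/
theorem alphas_count : alphas.length = 81 := by decide +kernel

/-- The composition argument of LEMMA DC(b): at `m = 4` the only type-1 character is `(1,1,1,1)`. -/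
theorem composition_four :
    (alphas.filter fun α => α.sum == 4) = [[1, 1, 1, 1]] := by decide +kernel

/-- LEMMA DC(b) checked numerically on all 141 invertible candidates:
`p_g = 1` iff all column sums are even, else `p_g = 0`. -/
theorem pg_eq :
    (invertible.all fun S => pg S == (if evenCols S then 1 else 0)) = true := by decide +kernel

/-- Hodge type counts `(#type 1, #type 2, #type 3)` of the five K3 members: `(1,19,1)` for Fermat,
`(1,7,1)` for square + triangle; hence `rank T = #type 1 + #type 3 = 2` and `ρ = 22 - 2 = 20`. -/
theorem hodge_characters_fiveK3 :
    (fiveK3.map fun S => (typeCount S 1, typeCount S 2, typeCount S 3))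
      = [(1, 19, 1), (1, 7, 1), (1, 7, 1), (1, 7, 1), (1, 7, 1)] := by decide +kernel

/-- `|Λ_A ∩ 𝔄₄|` over the admissible population takes exactly the values `{1,3,7,9,21}`
(SB-C308). -/
theorem frakA_sizes :
    ((invertible.filter noDividingVar).all fun S =>
        [1, 3, 7, 9, 21].contains (alphas.filter fun α => inLambdaFrakA S α).length) = true ∧
    ([1, 3, 7, 9, 21].all fun v => (invertible.filter noDividingVar).any fun S =>
        (alphas.filter fun α => inLambdaFrakA S α).length == v) = true := by
  constructor <;> decide +kernel

end DelsarteCensus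
end Summit.HodgeConjecture.HodgeConjecture.Theorems
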